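import Summits.Schanuel.Schanuel.Theorems.ZilberEacPlaneCurveRows
import Mathlib.RingTheory.Polynomial.Resultant.Basic
import HarnessLib

/-!
# Arbitrary base branches, LXVI: ELIMINATION of `x₀` between the curve `F(x₀, x₁) = 0` and a
# relation `H(x₀, y₁) = 0` — a nonzero `D(x₁, y₁)` vanishing on all common solutions

HONEST FRAMING.  Cell `pub-schanuel` (Zilber's Exponential-Algebraic Closedness, case ladder;
host summit Schanuel), seat 2, gen 31.  The transcendence route to Mantova–Masser's question
along a BOUNDED branch at infinity (file LXVII: `x₀ → ∞`, `x₁ → θ`) turns a hypothetical relation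
`H(x₀, e^{x₁}) = 0` along the branch into a relation `D(x₁, e^{x₁}) = 0` between `x₁` and `e^{x₁}`,
which the identity theorem and the transcendence of `e^z` forbid.  This file is the algebra:
**`exists_eliminant`** — `F ∈ ℂ[x₀][x₁]` irreducible of `x₁`-degree `≥ 2`, `H ∈ ℂ[x₀][y₁]`
nonzero, and `f, g` the same polynomials written with `x₀` as the variable over
`R = ℂ[x₁][y₁]` (given through their evaluations); then `D = Res_{x₀}(f, g) ∈ R` is NONZERO and
vanishes at every `(x₁, y₁)` for which `F(x₀, x₁) = 0 = H(x₀, y₁)` have a common solution `x₀`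
(Mathlib's resultant: `f·p + g·q = D`, and `D` specialises to the resultant of the specialised
polynomials, which is nonzero at a well-chosen point `(a, b)`: `a` off the vertical lines through
the finitely many `x₀` with `H(x₀, ·) ≡ 0` and off the zeros of the leading coefficients, `b` off
the zeros of `H(x₀, ·)` at the roots `x₀` of `F(·, a)`).  Also the small lemmas
`natDegree_eq_one_of_vanish_horizontal` (an irreducible `F` vanishing on a horizontal line is that
line) and `exists_exp_relation_ne_zero` (`D ≠ 0 ⟹ D(z, e^z) ≢ 0`: the transcendence of `exp` over
`ℂ(z)`, by the Liouville-type elimination lemma of `EACDensityQuestion`).  [folklore algebra];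
nothing here is specific to Schanuel's conjecture (neither used nor implied); Mantova–Masser's
question (PLMS 2024 §1 p. 5) and EC(3,2) stay OPEN.
-/

noncomputable section

open Filter Topology Set Complex Polynomial
open Literature.NumberTheory.Transcendental Literature.ModelTheory.Zilber
open Literature.ModelTheory.ExponentialFields

set_option linter.dupNamespace false

namespace Summit.Schanuel.Schanuel.Theorems

section Eliminant

/-! ## Part A. Small lemmas on two-variable polynomials -/

/-- `F(·, a)` as a polynomial in `x₀`: `(F.eval (C a))(c) = F(c, a)`. [folklore] -/
theorem eval_eval_C (F : ℂ[X][X]) (a c : ℂ) :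
    (F.eval (Polynomial.C a)).eval c = (F.map (Polynomial.evalRingHom c)).eval a := by
  rw [Polynomial.eval_map, ← Polynomial.coe_evalRingHom, Polynomial.eval, Polynomial.hom_eval₂]
  simp

/-- **An irreducible `F ∈ ℂ[x₀][x₁]` vanishing on the horizontal line `x₁ = a` has
`x₁`-degree `1`.** [folklore] -/
theorem natDegree_eq_one_of_vanish_horizontal {F : ℂ[X][X]} (hFirr : Irreducible F) {a : ℂ}
    (h : ∀ c : ℂ, (F.map (Polynomial.evalRingHom c)).eval a = 0) : F.natDegree = 1 := by
  have hroot : F.IsRoot (Polynomial.C a) := by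
    rw [Polynomial.IsRoot]
    refine Polynomial.funext fun c => ?_
    rw [eval_eval_C, Polynomial.eval_zero]
    exact h c
  obtain ⟨G, hG⟩ := Polynomial.dvd_iff_isRoot.2 hroot
  rcases hFirr.isUnit_or_isUnit hG with hu | hu
  · have := Polynomial.natDegree_eq_zero_of_isUnit hu
    rw [Polynomial.natDegree_X_sub_C] at this
    exact absurd this one_ne_zero
  · have hGdeg := Polynomial.natDegree_eq_zero_of_isUnit hu
    have hG0 : G ≠ 0 := hu.ne_zero
    rw [hG, Polynomial.natDegree_mul (Polynomial.X_sub_C_ne_zero _) hG0, Polynomial.natDegree_X_sub_C,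
      hGdeg]

/-- The set of `a` at which all rows of a nonzero `P ∈ ℂ[s][t]` vanish is finite. [folklore] -/
theorem finite_setOf_rows_eq_zero (P : ℂ[X][X]) (hP : P ≠ 0) :
    {a : ℂ | P.map (Polynomial.evalRingHom a) = 0}.Finite := by
  obtain ⟨j, hj⟩ : ∃ j, P.coeff j ≠ 0 := by
    by_contra hall
    push Not at hall
    exact hP (Polynomial.ext fun j => by rw [hall j, Polynomial.coeff_zero])
  refine (Polynomial.finite_setOf_isRoot hj).subset fun a ha => ?_
  have h := congrArg (fun q : ℂ[X] => q.coeff j) ha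
  simp only [Set.mem_setOf_eq, Polynomial.coeff_map, Polynomial.coe_evalRingHom,
    Polynomial.coeff_zero] at h ⊢
  exact h

/-- A nonzero complex polynomial is nonzero somewhere. [folklore] -/
theorem exists_eval_ne_zero (p : ℂ[X]) (hp : p ≠ 0) : ∃ b : ℂ, p.eval b ≠ 0 := by
  by_contra hall
  push Not at hall
  exact hp (Polynomial.funext fun b => by rw [hall b, Polynomial.eval_zero])

/-- **`exp` is transcendental over `ℂ(z)`**: for `D ∈ ℂ[s][t]` nonzero, `D(z, e^z) ≠ 0` for some
`z` (along `z = k ∈ ℕ`, `e^{-k}` decays faster than every power: the Liouville-type elimination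
lemma applied to the reversed polynomial). [folklore] -/
theorem exists_exp_relation_ne_zero (D : ℂ[X][X]) (hD : D ≠ 0) :
    ∃ z : ℂ, (D.map (Polynomial.evalRingHom z)).eval (Complex.exp z) ≠ 0 := by
  classical
  by_contra hall
  push Not at hall
  set G : ℂ[X][X] := Polynomial.reflect D.natDegree D with hG
  have hG0 : G ≠ 0 := by
    rw [hG, Ne, Polynomial.reflect_eq_zero_iff]; exact hD
  refine hG0 (eq_zero_of_eval₂_eq_zero_of_superdecay G (fun k => (k : ℂ)) (fun k => Complex.exp (-(k : ℂ)))
    ?_ (fun k => Complex.exp_ne_zero _) ?_ ?_)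
  · simpa using tendsto_natCast_atTop_atTop (R := ℝ)
  · intro N
    have h := (Real.tendsto_pow_mul_exp_neg_atTop_nhds_zero N).comp (tendsto_natCast_atTop_atTop (R := ℝ))
    refine h.congr fun k => ?_
    simp only [Function.comp_apply, Complex.norm_exp, Complex.neg_re, Complex.natCast_re,
      Complex.norm_natCast]
    ring
  · intro k
    haveI := invertibleOfNonzero (Complex.exp_ne_zero (k : ℂ))
    have hrev := Polynomial.eval₂_reflect_mul_pow (Polynomial.evalRingHom (k : ℂ)) (Complex.exp (k : ℂ))
      D.natDegree D le_rfl
    rw [invOf_eq_inv, ← Complex.exp_neg] at hrev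
    have hDk : Polynomial.eval₂ (Polynomial.evalRingHom (k : ℂ)) (Complex.exp (k : ℂ)) D = 0 := by
      rw [← Polynomial.eval_map]; exact hall k
    rw [hDk] at hrev
    exact (mul_eq_zero.1 hrev).resolve_right (pow_ne_zero _ (Complex.exp_ne_zero _))

/-! ## Part B. The eliminant -/

/-- **Elimination of `x₀`.**  `F ∈ ℂ[x₀][x₁]` irreducible of `x₁`-degree `≥ 2`, `H ∈ ℂ[x₀][y₁]`
nonzero; `f, g ∈ R[x₀]` (`R = ℂ[x₁][y₁]`) with `f(x₀)|_{(x₁, y₁) = (a, b)} = F(x₀, a)` and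
`g(x₀)|_{(a, b)} = H(x₀, b)`.  Then some NONZERO `D ∈ R` has `D(a, b) = 0` whenever
`F(c, a) = 0 = H(c, b)` for some `c`. [folklore (the resultant)] (new in this form) -/
theorem exists_eliminant (F H : ℂ[X][X]) (hFirr : Irreducible F) (hF2 : 2 ≤ F.natDegree)
    (hH : H ≠ 0) (f g : Polynomial (ℂ[X][X]))
    (hf : ∀ a b c : ℂ, (f.map ((Polynomial.evalRingHom b).comp
      (Polynomial.mapRingHom (Polynomial.evalRingHom a)))).eval c =
      (F.map (Polynomial.evalRingHom c)).eval a)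
    (hg : ∀ a b c : ℂ, (g.map ((Polynomial.evalRingHom b).comp
      (Polynomial.mapRingHom (Polynomial.evalRingHom a)))).eval c =
      (H.map (Polynomial.evalRingHom c)).eval b) :
    ∃ D : ℂ[X][X], D ≠ 0 ∧ ∀ a b c : ℂ, (F.map (Polynomial.evalRingHom c)).eval a = 0 →
      (H.map (Polynomial.evalRingHom c)).eval b = 0 → (D.map (Polynomial.evalRingHom a)).eval b = 0 := by
  classical
  -- notation for the specialisation `(x₁, y₁) = (a, b)`
  set φ : ℂ → ℂ → (ℂ[X][X] →+* ℂ) := fun a b =>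
    (Polynomial.evalRingHom b).comp (Polynomial.mapRingHom (Polynomial.evalRingHom a)) with hφ
  have hφev : ∀ a b (P : ℂ[X][X]), φ a b P = (P.map (Polynomial.evalRingHom a)).eval b := by
    intro a b P; rfl
  have hF1 : F.natDegree ≠ 0 := by omega
  -- every `F(c, ·)` is a nonzero polynomial
  have hFc : ∀ c : ℂ, F.map (Polynomial.evalRingHom c) ≠ 0 := by
    intro c hc
    obtain ⟨j, hj⟩ := exists_coeff_not_isRoot_of_irreducible hFirr hF1 c
    apply hj
    have h := congrArg (fun q : ℂ[X] => q.coeff j) hc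
    simp only [Polynomial.coeff_map, Polynomial.coe_evalRingHom, Polynomial.coeff_zero] at h
    exact h
  -- `f` has positive degree: otherwise `F(c, a)` would not depend on `c`
  set m := f.natDegree with hm
  set n := g.natDegree with hn
  have hm0 : m ≠ 0 := by
    intro hm0
    have hfC := Polynomial.eq_C_of_natDegree_eq_zero hm0
    -- a point `(c₀, a₀)` of the curve
    obtain ⟨c₀, hc₀⟩ := exists_eval_ne_zero F.leadingCoeff
      (Polynomial.leadingCoeff_ne_zero.2 hFirr.ne_zero)
    obtain ⟨a₀, ha₀⟩ : ∃ a₀ : ℂ, (F.map (Polynomial.evalRingHom c₀)).eval a₀ = 0 := by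
      have hnd : (F.map (Polynomial.evalRingHom c₀)).natDegree = F.natDegree :=
        Polynomial.natDegree_map_of_leadingCoeff_ne_zero _ (by rwa [Polynomial.coe_evalRingHom])
      have hdeg : (F.map (Polynomial.evalRingHom c₀)).degree ≠ 0 := by
        rw [Polynomial.degree_eq_natDegree (hFc c₀), hnd]
        exact_mod_cast hF1
      obtain ⟨y, hy⟩ := IsAlgClosed.exists_root _ hdeg
      exact ⟨y, hy⟩
    have hall : ∀ c : ℂ, (F.map (Polynomial.evalRingHom c)).eval a₀ = 0 := by
      intro c
      rw [← hf a₀ 0 c, hfC, Polynomial.map_C, Polynomial.eval_C]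
      have h0 := hf a₀ 0 c₀
      rw [hfC, Polynomial.map_C, Polynomial.eval_C] at h0
      rw [h0, ha₀]
    have := natDegree_eq_one_of_vanish_horizontal hFirr hall
    omega
  -- the eliminant
  set D : ℂ[X][X] := Polynomial.resultant f g m n with hD
  obtain ⟨p, q, -, -, hpq⟩ := Polynomial.exists_mul_add_mul_eq_C_resultant f g
    (le_refl m) (le_refl n) (Or.inl hm0)
  have hpq' : f * p + g * q = Polynomial.C D := hpq
  refine ⟨D, ?_, ?_⟩
  swap
  · -- `D` vanishes at the common solutions
    intro a b c hFca hHcb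
    have h := congrArg (fun P : Polynomial (ℂ[X][X]) => (P.map (φ a b)).eval c) hpq'
    simp only [Polynomial.map_add, Polynomial.map_mul, Polynomial.eval_add, Polynomial.eval_mul,
      Polynomial.map_C, Polynomial.eval_C] at h
    rw [hf, hg, hFca, hHcb, zero_mul, zero_mul, add_zero] at h
    rw [← hφev, ← h]
  -- `D ≠ 0`: specialise at a good point `(a, b)`
  intro hD0
  have hf0 : f ≠ 0 := fun h => hm0 (by rw [hm, h, Polynomial.natDegree_zero])
  have hg0 : g ≠ 0 := by
    intro h
    -- `H ≠ 0` gives a point where `H(c, b) ≠ 0`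
    obtain ⟨j, hj⟩ : ∃ j, H.coeff j ≠ 0 := by
      by_contra hall; push Not at hall
      exact hH (Polynomial.ext fun j => by rw [hall j, Polynomial.coeff_zero])
    obtain ⟨c, hc⟩ := exists_eval_ne_zero _ hj
    have hHc : H.map (Polynomial.evalRingHom c) ≠ 0 := by
      intro h0
      have := congrArg (fun q : ℂ[X] => q.coeff j) h0
      simp only [Polynomial.coeff_map, Polynomial.coe_evalRingHom, Polynomial.coeff_zero] at this
      exact hc this
    obtain ⟨b, hb⟩ := exists_eval_ne_zero _ hHc
    apply hb
    rw [← hg 0 b c, h, Polynomial.map_zero, Polynomial.eval_zero]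
  have hlcf : f.leadingCoeff ≠ 0 := Polynomial.leadingCoeff_ne_zero.2 hf0
  have hlcg : g.leadingCoeff ≠ 0 := Polynomial.leadingCoeff_ne_zero.2 hg0
  -- finitely many bad `a`
  set A₁ : Set ℂ := {a | f.leadingCoeff.map (Polynomial.evalRingHom a) = 0} with hA₁
  set A₃ : Set ℂ := {a | g.leadingCoeff.map (Polynomial.evalRingHom a) = 0} with hA₃
  set T : Set ℂ := {c | H.map (Polynomial.evalRingHom c) = 0} with hT
  set A₂ : Set ℂ := ⋃ c ∈ T, {a | (F.map (Polynomial.evalRingHom c)).IsRoot a} with hA₂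
  have hA₁f : A₁.Finite := finite_setOf_rows_eq_zero _ hlcf
  have hA₃f : A₃.Finite := finite_setOf_rows_eq_zero _ hlcg
  have hTf : T.Finite := finite_setOf_rows_eq_zero _ hH
  have hA₂f : A₂.Finite := hTf.biUnion fun c _ => Polynomial.finite_setOf_isRoot (hFc c)
  obtain ⟨a, ha⟩ := ((hA₁f.union hA₃f).union hA₂f).infinite_compl.nonempty
  simp only [Set.mem_compl_iff, Set.mem_union, not_or] at ha
  obtain ⟨⟨ha₁, ha₃⟩, ha₂⟩ := ha
  -- the specialised `f` does not depend on `b`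
  set Fa : ℂ[X] := f.map (φ a 0) with hFa
  have hFab : ∀ b, f.map (φ a b) = Fa := by
    intro b
    refine Polynomial.funext fun c => ?_
    rw [hFa, hf, hf]
  have hFaev : ∀ c, Fa.eval c = (F.map (Polynomial.evalRingHom c)).eval a := fun c => by rw [hFa, hf]
  -- its degree is `m`
  obtain ⟨b₀, hb₀⟩ := exists_eval_ne_zero _ ha₁
  have hFam : Fa.coeff m = (f.leadingCoeff.map (Polynomial.evalRingHom a)).eval b₀ := by
    rw [← hFab b₀, Polynomial.coeff_map, ← hφev]; rfl
  have hFam0 : Fa.coeff m ≠ 0 := by rw [hFam]; exact hb₀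
  have hFa0 : Fa ≠ 0 := fun h => hFam0 (by rw [h, Polynomial.coeff_zero])
  have hFadeg : Fa.natDegree = m := by
    refine le_antisymm ?_ (Polynomial.le_natDegree_of_ne_zero hFam0)
    rw [hFa]; exact Polynomial.natDegree_map_le
  -- finitely many bad `b`
  set B₂ : Set ℂ := {b | (g.leadingCoeff.map (Polynomial.evalRingHom a)).IsRoot b} with hB₂
  set B₁ : Set ℂ := ⋃ c ∈ {c : ℂ | Fa.IsRoot c}, {b | (H.map (Polynomial.evalRingHom c)).IsRoot b}
    with hB₁
  have hB₂f : B₂.Finite := Polynomial.finite_setOf_isRoot ha₃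
  have hHc : ∀ c, Fa.IsRoot c → H.map (Polynomial.evalRingHom c) ≠ 0 := by
    intro c hc hzero
    apply ha₂
    rw [hA₂, Set.mem_iUnion₂]
    refine ⟨c, hzero, ?_⟩
    rw [Set.mem_setOf_eq, Polynomial.IsRoot, ← hFaev]
    exact hc
  have hB₁f : B₁.Finite :=
    (Polynomial.finite_setOf_isRoot hFa0).biUnion fun c hc => Polynomial.finite_setOf_isRoot (hHc c hc)
  obtain ⟨b, hb⟩ := (hB₂f.union hB₁f).infinite_compl.nonempty
  simp only [Set.mem_compl_iff, Set.mem_union, not_or] at hb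
  obtain ⟨hb₂, hb₁⟩ := hb
  -- the specialised `g`
  set Gb : ℂ[X] := g.map (φ a b) with hGb
  have hGbn : Gb.coeff n = (g.leadingCoeff.map (Polynomial.evalRingHom a)).eval b := by
    rw [hGb, Polynomial.coeff_map, ← hφev]; rfl
  have hGbn0 : Gb.coeff n ≠ 0 := by rw [hGbn]; exact hb₂
  have hGbdeg : Gb.natDegree = n := by
    refine le_antisymm ?_ (Polynomial.le_natDegree_of_ne_zero hGbn0)
    rw [hGb]; exact Polynomial.natDegree_map_le
  -- no common root
  have hcop : IsCoprime Fa Gb := by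
    refine (Polynomial.isCoprime_iff_aeval_ne_zero_of_isAlgClosed ℂ ℂ Fa Gb).2 fun c => ?_
    by_cases hc : Fa.IsRoot c
    · right
      have hbc : ¬ (H.map (Polynomial.evalRingHom c)).IsRoot b := by
        intro hroot
        apply hb₁
        rw [hB₁, Set.mem_iUnion₂]
        exact ⟨c, hc, hroot⟩
      rw [Polynomial.coe_aeval_eq_eval, hGb, hg]
      exact fun h => hbc h
    · left
      rw [Polynomial.coe_aeval_eq_eval]
      exact hc
  have hres : Polynomial.resultant Fa Gb ≠ 0 := by
    intro h
    rw [Polynomial.resultant_eq_zero_iff] at h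
    exact h.2 hcop
  apply hres
  have : Polynomial.resultant Fa Gb = Polynomial.resultant Fa Gb m n := by
    rw [← hFadeg, ← hGbdeg]
  rw [this, ← hFab b, hGb, Polynomial.resultant_map_map]
  change (φ a b) D = 0
  rw [hD0, map_zero]

end Eliminant

end Summit.Schanuel.Schanuel.Theorems

end
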